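import Mathlib
import Summits.Ventures.HodgeRepro2.LevelPositivity
import Summits.Ventures.HodgeRepro2.LiuOscillator
import Summits.Ventures.HodgeRepro2.T6B5Data
import Summits.Ventures.HodgeRepro2.T6B5Datum
import Summits.Ventures.HodgeRepro2.T6B5Hyp
import Summits.Ventures.HodgeRepro2.T6B3Hyp
import Summits.Ventures.HodgeRepro2.T6B5Main
import Summits.Ventures.HodgeRepro2.T6B5Toy
import Summits.Ventures.HodgeRepro2.T6B5CentralHyp

/-!
# T6B5CentralToy — Tier 6, sub-goal B5: the non-vacuity witness of the displayed App. D.1 Step 3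
(README §10.5(ii)(b),(c),(d))

The accepted eight-display toy `T6B5Toy.toyModel` (trivial group `G = Unit`, one class) CANNOT carry the new
display `Hyp.Liu2021_AppD1_Step3`: with `G` trivial every scalar isometry is `1`, so the display forces
`χ(z) = 1` for the character `χ` of EVERY adèlic oscillator triple and every `z` — proved below as
`toyModel_display_forces_trivial`, a kernel record of why a second toy is needed (no non-trivial character of
`E^1 \ (A_E^∞)^1` is constructed in the tree, so the display is not refuted on `toyModel` either; `toyModel` is
simply not a toy for it).

The second toy `toyModelChar K c χEF` (for `K : Type`, the universe of the datum's carriers): the group is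
`(A_E^∞)^1` itself with the DISCRETE topology (`ToyG`), the classes are the triples, and the class of
`t = (μ, ε, χ)` is the one-dimensional representation `ω_t(z) = χ(z) ·` on `ℂ` (`charRep`); the scalar datum is the
identity into the (whole) centre. On it hold JOINTLY: the displayed Def. 4.11 (`ω_t` irreducible, smooth,
admissible), the author-copy Ullmo–Yafaev display, the displayed App. D.1 Step 3 (definitionally), and t6-p6's two
Thm. 4.18 displays at the shape with threshold the trivial subgroup — every display `B5_main_central` consumes
(`exists_model_central`); the td-group hypotheses of `B5_main_central_schur` hold on `ToyG` (`toyG_instances`).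
NOT claimed on this toy: t6-p6's Cor. 4.20 display (its completeness clause would list in a `Finset` the classes
with non-zero invariants at the trivial level, and on this toy EVERY class has non-zero invariants there — the
design that makes the central-character display hold makes Cor. 4.20's finiteness clause fail; `B5_main_central`
does not consume Cor. 4.20). A single toy carrying all nine displays is therefore not offered: reported, not claimed.
README §8(d): uses an L-value-free non-vanishing device: NO.
-/

namespace Summit.Ventures.HodgeRepro2.T6.B5CentralToy

open Summit.Ventures.HodgeRepro2.LevelPositivity Summit.Ventures.HodgeRepro2.ShimuraData
  Summit.Ventures.HodgeRepro2.T6.B5Data Summit.Ventures.HodgeRepro2.T6.B5Datum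
  Summit.Ventures.HodgeRepro2.T6.Hyp Summit.Ventures.HodgeRepro2.T6.B5Main Summit.Ventures.HodgeRepro2.T6.B5Toy
open Module

section ForcesTrivial

universe u

variable (K : Type u) [Field K] [NumberField K] [NumberField.IsCMField K] (c : Liu.IdeleConjugation K)
  (χEF : Liu.QuadraticCharacter K c)

/-- On the accepted eight-display toy (trivial group), the displayed App. D.1 Step 3 — for ANY scalar datum —
forces the character of every adèlic oscillator triple to be trivial: the trivial-group toy is not a toy for the
ninth display. -/
theorem toyModel_display_forces_trivial (𝓢 : ScalarDatum (toyModel K c χEF))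
    (hD : Liu2021_AppD1_Step3 (toyModel K c χEF) 𝓢) (t : Liu.OscillatorTriple K c χEF)
    (z : ↥(Liu.oneFinIdeles K c)) : t.χ.toFun z = 1 := by
  have h1 := hD t z (1 : ℂ)
  have h2 : (toyModel K c χEF).ω ((toyModel K c χEF).osc t)
      ((𝓢.scalar z : Subgroup.center (toyModel K c χEF).G) : (toyModel K c χEF).G) (1 : ℂ) = (1 : ℂ) := rfl
  rw [h2, smul_eq_mul, mul_one] at h1
  exact Units.val_eq_one.mp h1.symm

/-- Any representation on the one-dimensional space `ℂ` is irreducible (the accepted `toy_isIrreducible` with the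
group and the action generic). -/
theorem isIrreducible_of_C {G : Type*} [Monoid G] (ρ : Representation ℂ G ℂ) : ρ.IsIrreducible where
  exists_pair_ne := ⟨⊥, ⊤, fun h =>
    (bot_ne_top : (⊥ : Submodule ℂ ℂ) ≠ ⊤) (congrArg Subrepresentation.toSubmodule h)⟩
  eq_bot_or_eq_top p := by
    rcases (eq_bot_or_eq_top p.toSubmodule : p.toSubmodule = ⊥ ∨ p.toSubmodule = ⊤) with h | h
    · exact Or.inl (Subrepresentation.toSubmodule_injective h)
    · exact Or.inr (Subrepresentation.toSubmodule_injective h)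

end ForcesTrivial

section Toy

variable (K : Type) [Field K] [NumberField K] [NumberField.IsCMField K] (c : Liu.IdeleConjugation K)
  (χEF : Liu.QuadraticCharacter K c)

/-- The toy group: `(A_E^∞)^1` (p2's `Liu.oneFinIdeles K c`) with the DISCRETE topology — a type synonym, so that
the subspace topology of the finite idèles is not inherited. -/
def ToyG : Type := ↥(Liu.oneFinIdeles K c)

/-- The group structure of the toy group: that of `(A_E^∞)^1` (transported along the synonym). -/
noncomputable instance : CommGroup (ToyG K c) := inferInstanceAs (CommGroup ↥(Liu.oneFinIdeles K c))

/-- The topology of the toy group: the discrete one (`⊥`). -/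
instance : TopologicalSpace (ToyG K c) := ⊥

/-- The toy group is discrete (by definition of its topology). -/
instance : DiscreteTopology (ToyG K c) := ⟨rfl⟩

/-- A discrete group is a topological group (multiplication and inversion are continuous). -/
instance : IsTopologicalGroup (ToyG K c) where
  continuous_mul := continuous_of_discreteTopology
  continuous_inv := continuous_of_discreteTopology

/-- A discrete space is locally compact (the singleton of a point is a compact neighbourhood). -/
instance : LocallyCompactSpace (ToyG K c) :=
  ⟨fun x _ hn => ⟨{x}, (isOpen_discrete _).mem_nhds (Set.mem_singleton x),
    Set.singleton_subset_iff.mpr (mem_of_mem_nhds hn), isCompact_singleton⟩⟩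

/-- A discrete space is first countable (the neighbourhood filter of a point is principal). -/
instance : FirstCountableTopology (ToyG K c) :=
  ⟨fun _ => by rw [nhds_discrete]; infer_instance⟩

/-- The td-group hypotheses of `B5_main_central_schur` hold on the toy group. -/
theorem toyG_instances : LocallyCompactSpace (ToyG K c) ∧ T2Space (ToyG K c) ∧
    TotallyDisconnectedSpace (ToyG K c) ∧ FirstCountableTopology (ToyG K c) :=
  ⟨inferInstance, inferInstance, inferInstance, inferInstance⟩

/-- A character of `E^1 \ (A_E^∞)^1` read on the toy group. -/
noncomputable def charHom (χ : Liu.OneCharacter K c) : ToyG K c →* ℂˣ where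
  toFun z := χ.toFun z
  map_one' := χ.toFun.map_one
  map_mul' x y := χ.toFun.map_mul x y

/-- The one-dimensional representation `z ↦ χ(z) ·` of the toy group on `ℂ`. -/
noncomputable def charRep (χ : Liu.OneCharacter K c) : Representation ℂ (ToyG K c) ℂ :=
  (Algebra.lmul ℂ ℂ).toMonoidHom.comp ((Units.coeHom ℂ).comp (charHom K c χ))

/-- The character representation acts by the scalar `χ z`: `charRep χ z w = χ z * w`. -/
theorem charRep_apply (χ : Liu.OneCharacter K c) (z : ToyG K c) (w : ℂ) :
    charRep K c χ z w = ((χ.toFun z : ℂˣ) : ℂ) * w := rfl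

/-- The second toy datum: group `(A_E^∞)^1` (discrete), classes = the triples, `ω_t = χ_t ·` on `ℂ`; the other
carriers as in the accepted `toyModel` (`M̃ = Ω = ℚ`, `Hom = ℚ`, one isogeny class, `galOrbit = ⊤`). -/
noncomputable abbrev toyModelChar : LiuAlbaneseDatum K c χEF where
  n := 3
  G := ToyG K c
  neat := fun _ => True
  IsIndex := fun _ => True
  Rep := Liu.OscillatorTriple K c χEF
  osc := id
  W := fun _ => ℂ
  ω := fun t => charRep K c t.χ
  mult := fun _ _ => 1
  galOrbit := ⊤
  IsogClass := Unit
  albanese := fun _ => ()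
  cmVariety := fun _ => ()
  Mt := fun _ => ⊥
  Omega := fun _ => (⊥ : IntermediateField ℚ ℂ)
  ρΩ := fun _ => Representation.trivial (⊥ : IntermediateField ℚ ℂ) (ToyG K c) (⊥ : IntermediateField ℚ ℂ)
  HomQ := fun _ _ => ℚ

/-- The scalar datum of the toy: `(A_E^∞)^1 → Z(ToyG) = ToyG`, the identity (the toy group is commutative). -/
noncomputable def toyScalar : ScalarDatum (toyModelChar K c χEF) where
  scalar := MonoidHom.codRestrict
    ({ toFun := fun z => (z : ToyG K c), map_one' := rfl, map_mul' := fun _ _ => rfl } :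
      ↥(Liu.oneFinIdeles K c) →* ToyG K c)
    (Subgroup.center (ToyG K c)) (fun z => Subgroup.mem_center_iff.mpr fun g => mul_comm g z)

/-- The displayed App. D.1 Step 3 holds on the toy: the scalar `z` acts on `ω_t` by `χ_t(z)` by construction. -/
theorem toyModelChar_display : Liu2021_AppD1_Step3 (toyModelChar K c χEF) (toyScalar K c χEF) :=
  fun _ _ _ => rfl

/-- B5's two displays (Def. 4.11, Ullmo–Yafaev) hold on the second toy. -/
theorem toyModelChar_hypotheses :
    Liu2021_Def4_11 (toyModelChar K c χEF) ∧ UllmoYafaev2014_neatInside (toyModelChar K c χEF) := by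
  refine ⟨fun t => ⟨isIrreducible_of_C _, fun _ => isOpen_discrete _, fun L _ => inferInstance⟩,
    fun L hL => ?_⟩
  refine ⟨L, hL, le_rfl, ⟨?_⟩, fun _ _ => trivial⟩
  rw [Subgroup.subgroupOf_self, Subgroup.index_top]
  exact one_ne_zero

/-- The trivial subgroup of the toy group as an open subgroup (discrete topology). -/
noncomputable def botLevel : OpenSubgroup (ToyG K c) := ⟨⊥, isOpen_discrete _⟩

/-- The bottom level `{1}` of the toy group is compact (a singleton). -/
theorem botLevel_isCompact : IsCompact ((botLevel K c : OpenSubgroup (ToyG K c)) : Set (ToyG K c)) := by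
  show IsCompact ((⊥ : Subgroup (ToyG K c)) : Set (ToyG K c))
  rw [Subgroup.coe_bot]
  exact isCompact_singleton

/-- `dim_ℚ (ℚ)^L = 1` for the trivial representation on `⊥ = ℚ` of the toy group (the accepted
`toy_finrank_invariants_Q` with the group generic). -/
theorem toy_finrank_invariants_Q' (L : Subgroup (ToyG K c)) :
    finrank ℚ (invariants (Representation.trivial (⊥ : IntermediateField ℚ ℂ) (ToyG K c)
      (⊥ : IntermediateField ℚ ℂ)) L) = 1 := by
  rw [invariants_trivial]
  rw [LinearEquiv.finrank_eq ((Submodule.topEquiv (R := (⊥ : IntermediateField ℚ ℂ))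
    (M := (⊥ : IntermediateField ℚ ℂ))).restrictScalars ℚ)]
  exact IntermediateField.finrank_bot

/-- t6-p6's two Thm. 4.18 displays hold on the shape of the second toy at the threshold `botLevel`
(`dim ω_t^L ≤ 1 = dim Ω^L = dim Hom`). -/
theorem toyModelChar_B3_hypotheses :
    Liu2021_Thm4_18_iso (shape (toyModelChar K c χEF) (toyModelChar_hypotheses K c χEF).1 (botLevel K c)) ∧
    Liu2021_Thm4_18_1 (shape (toyModelChar K c χEF) (toyModelChar_hypotheses K c χEF).1 (botLevel K c)) := by
  refine ⟨fun t _ L _ => ?_, fun μ _ L _ => ?_⟩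
  · show finrank ℂ (invariants (charRep K c t.χ) (L.1 : Subgroup (ToyG K c))) ≤
      finrank ℚ (invariants (Representation.trivial (⊥ : IntermediateField ℚ ℂ) (ToyG K c)
        (⊥ : IntermediateField ℚ ℂ)) (L.1 : Subgroup (ToyG K c)))
    rw [toy_finrank_invariants_Q']
    calc finrank ℂ (invariants (charRep K c t.χ) (L.1 : Subgroup (ToyG K c))) ≤ finrank ℂ ℂ :=
          Submodule.finrank_le _
      _ = 1 := Module.finrank_self ℂ
  · show finrank ℚ (invariants (Representation.trivial (⊥ : IntermediateField ℚ ℂ) (ToyG K c)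
        (⊥ : IntermediateField ℚ ℂ)) (L.1 : Subgroup (ToyG K c))) = finrank ℚ ℚ
    rw [toy_finrank_invariants_Q', Module.finrank_self]

/-- README §10.5(ii)(c),(d) for `B5_main_central`: the carriers with a scalar datum are instantiable with every
display it consumes true at once — Def. 4.11, Ullmo–Yafaev, App. D.1 Step 3, and t6-p6's two Thm. 4.18 displays at
the shape — for every choice of the cell's Liu parameters `(K, c, χEF)` with `K : Type`. -/
theorem exists_model_central : ∃ (𝓛 : LiuAlbaneseDatum K c χEF) (𝓢 : ScalarDatum 𝓛)
    (h411 : Liu2021_Def4_11 𝓛), UllmoYafaev2014_neatInside 𝓛 ∧ Liu2021_AppD1_Step3 𝓛 𝓢 ∧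
      ∃ K₀ : OpenSubgroup 𝓛.G, IsCompact (K₀ : Set 𝓛.G) ∧
        Liu2021_Thm4_18_iso (shape 𝓛 h411 K₀) ∧ Liu2021_Thm4_18_1 (shape 𝓛 h411 K₀) :=
  ⟨toyModelChar K c χEF, toyScalar K c χEF, (toyModelChar_hypotheses K c χEF).1,
    (toyModelChar_hypotheses K c χEF).2, toyModelChar_display K c χEF, botLevel K c, botLevel_isCompact K c,
    toyModelChar_B3_hypotheses K c χEF⟩

end Toy

end Summit.Ventures.HodgeRepro2.T6.B5CentralToy
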